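import Mathlib
import Summits.Ventures.PercRepro2.Defs
import Summits.Ventures.PercRepro2.Graph
import Summits.Ventures.PercRepro2.HullDefs

/-!
# The two-colour BHK rows (2C-1.3) and (2C-1.4) on the free fibre
(blind cell PercRepro2, night-4 g37, 2026-08-29; `proofs/NIGHT4-G37.md` §2)

On the free fibre (uniform 2-colouring `ζ : Config E`, red = `ζ e = true`, blue = the complement
`blue ζ`) let `U = {h ∉ H_l} = {h ∉ C_R(l) ∪ C_B(l)}` be the TWO-COLOUR avoidance of `h` by `l`
(`avoidBoth`); more generally `avoidRB l X Y = {C_R(l) ∩ X = ∅, C_B(l) ∩ Y = ∅}`.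

* **(2C-1.4)** `CrossRow` — the two-colour cross-cluster statement: conditionally on `U`, increasing
  functionals of `C_R(l)` and of `C_R(h)` are NEGATIVELY correlated:
  `#{U, C_R(l) ∈ 𝒰, C_R(h) ∈ 𝒱} · #U ≤ #{U, C_R(l) ∈ 𝒰} · #{U, C_R(h) ∈ 𝒱}` for all up-sets
  `𝒰, 𝒱` of vertex sets.  Its one-colour ancestor is BHK06 Thm 1.4 (`bhk_cross_cluster`,
  conditioning on `h ∉ C_R(l)` only).
* **(2C-1.3)** `SameRow` — the two-colour same-cluster statement with avoided sets `X` (red) and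
  `Y` (blue): conditionally on `avoidRB l X Y`, increasing functionals of `C_R(l)` are
  POSITIVELY correlated.  Its one-colour ancestor is BHK06 Thm 1.3 / van den Berg–Kahn
  (`Y = ∅`).  The row of record is the SAME set avoided in both colours, `X = Y = S`
  (`SameRow_all`): the census (mining/night-4/g37/, kit j327318 / j327347 / j327351) finds it
  violation-free on every connected graph with `n ≤ 6`, every `l` and every `S` with `|S| ≤ 3`
  (3,260 instances with a nonempty avoidance set, all pairs of principal up-sets), and the cross row
  (2C-1.4) violation-free on every connected graph with `n ≤ 7` and every `(l, h)` (16,722 instances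
  at `n = 7`, 1,458 at `n = 6`; principal and 2-generated up-sets); the shape `X = Y` is sharp:
  `Y ⊊ X` (`|Y| = 1 < |X|`) has 232 violating pairs in 50 instances at `n = 6`, `X = ∅ ≠ Y` and
  disjoint `X, Y` already violate at `n = 5` (NIGHT4-G37.md §2).

Definitions only (the statements as counting inequalities, the colour-swap symmetry of `U` and of
the cluster counts of `h`, and the closures over all finite graphs).
-/

namespace Summit.Ventures.PercRepro2

namespace TwoColour

open Hull

variable {V : Type*} {E : Type*} [Fintype E] [DecidableEq E]

open scoped Classical

variable (ends : E → Sym2 V)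

/-! ## The two-colour avoidance sets -/

/-- The two-colour avoidance `U = {h ∉ H_l} = {h ∉ C_R(l) ∪ C_B(l)}`. -/
noncomputable def avoidBoth (l h : V) : Finset (Config E) :=
  Finset.univ.filter fun ζ => h ∉ hull ends ζ l

/-- The general two-colour avoidance `{C_R(l) ∩ X = ∅, C_B(l) ∩ Y = ∅}`. -/
noncomputable def avoidRB (l : V) (X Y : Set V) : Finset (Config E) :=
  Finset.univ.filter fun ζ =>
    (∀ x ∈ X, x ∉ cluster ends ζ l) ∧ (∀ y ∈ Y, y ∉ cluster ends (blue ζ) l)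

/-- Membership in `avoidBoth`. -/
lemma mem_avoidBoth {l h : V} {ζ : Config E} :
    ζ ∈ avoidBoth ends l h ↔ h ∉ hull ends ζ l := by
  simp [avoidBoth]

/-- Membership in `avoidRB`. -/
lemma mem_avoidRB {l : V} {X Y : Set V} {ζ : Config E} :
    ζ ∈ avoidRB ends l X Y ↔
      (∀ x ∈ X, x ∉ cluster ends ζ l) ∧ (∀ y ∈ Y, y ∉ cluster ends (blue ζ) l) := by
  simp [avoidRB]

/-- `U` is the general avoidance with `X = Y = {h}`. -/
lemma avoidBoth_eq_avoidRB (l h : V) : avoidBoth ends l h = avoidRB ends l {h} {h} := by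
  ext ζ
  simp only [mem_avoidBoth, mem_avoidRB, Set.mem_singleton_iff, forall_eq, hull, Set.mem_union]
  tauto

/-- `U` is colour-symmetric: `ζ ∈ U ↔ blue ζ ∈ U`. -/
lemma blue_mem_avoidBoth_iff {l h : V} {ζ : Config E} :
    blue ζ ∈ avoidBoth ends l h ↔ ζ ∈ avoidBoth ends l h := by
  simp only [mem_avoidBoth, hull_blue]

/-! ## The rows -/

/-- **(2C-1.4)**, the two-colour cross-cluster row at `(l, h)`: for all up-sets `𝒰, 𝒱` of vertex
sets, `#{U, C_R(l) ∈ 𝒰, C_R(h) ∈ 𝒱} · #U ≤ #{U, C_R(l) ∈ 𝒰} · #{U, C_R(h) ∈ 𝒱}`. -/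
def CrossRow (l h : V) : Prop :=
  ∀ 𝒰 𝒱 : Set (Set V), IsUpperSet 𝒰 → IsUpperSet 𝒱 →
    ((avoidBoth ends l h).filter fun ζ => cluster ends ζ l ∈ 𝒰 ∧ cluster ends ζ h ∈ 𝒱).card *
        (avoidBoth ends l h).card ≤
      ((avoidBoth ends l h).filter fun ζ => cluster ends ζ l ∈ 𝒰).card *
        ((avoidBoth ends l h).filter fun ζ => cluster ends ζ h ∈ 𝒱).card

/-- **(2C-1.3)**, the two-colour same-cluster row at `l` with the avoided sets `X` (red) and `Y`
(blue): for all up-sets `𝒰₁, 𝒰₂` of vertex sets,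
`#{A, C_R(l) ∈ 𝒰₁ ∩ 𝒰₂} · #A ≥ #{A, C_R(l) ∈ 𝒰₁} · #{A, C_R(l) ∈ 𝒰₂}` with `A = avoidRB l X Y`. -/
def SameRow (l : V) (X Y : Set V) : Prop :=
  ∀ 𝒰₁ 𝒰₂ : Set (Set V), IsUpperSet 𝒰₁ → IsUpperSet 𝒰₂ →
    ((avoidRB ends l X Y).filter fun ζ => cluster ends ζ l ∈ 𝒰₁).card *
        ((avoidRB ends l X Y).filter fun ζ => cluster ends ζ l ∈ 𝒰₂).card ≤
      ((avoidRB ends l X Y).filter fun ζ => cluster ends ζ l ∈ 𝒰₁ ∧ cluster ends ζ l ∈ 𝒰₂).card *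
        (avoidRB ends l X Y).card

/-- The principal instance of (2C-1.4): `#{U, o ∈ C_R(l), b ∈ C_R(h)} · #U ≤ #{U, o ∈ C_R(l)} · #{U, b ∈ C_R(h)}`. -/
theorem crossRow_principal {l h : V} (hc : CrossRow ends l h) (o b : V) :
    ((avoidBoth ends l h).filter fun ζ => o ∈ cluster ends ζ l ∧ b ∈ cluster ends ζ h).card *
        (avoidBoth ends l h).card ≤
      ((avoidBoth ends l h).filter fun ζ => o ∈ cluster ends ζ l).card *
        ((avoidBoth ends l h).filter fun ζ => b ∈ cluster ends ζ h).card :=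
  hc {S | o ∈ S} {S | b ∈ S} (fun _ _ hST ho => hST ho) (fun _ _ hST hb => hST hb)

/-! ## The colour swap on the counts of `h` -/

/-- The colour swap is a bijection of `U` exchanging the two clusters of `h`:
`#{U, C_R(h) ∈ 𝒱} = #{U, C_B(h) ∈ 𝒱}`. -/
theorem card_filter_cluster_h_blue (l h : V) (𝒱 : Set (Set V)) :
    ((avoidBoth ends l h).filter fun ζ => cluster ends ζ h ∈ 𝒱).card =
      ((avoidBoth ends l h).filter fun ζ => cluster ends (blue ζ) h ∈ 𝒱).card := by
  refine Finset.card_bij (fun ζ _ => blue ζ) ?_ ?_ ?_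
  · intro ζ hζ
    simp only [Finset.mem_filter] at hζ ⊢
    exact ⟨(blue_mem_avoidBoth_iff ends).2 hζ.1, by simpa [blue_blue] using hζ.2⟩
  · intro ζ₁ _ ζ₂ _ h
    have := congrArg blue h
    simpa [blue_blue] using this
  · intro η hη
    simp only [Finset.mem_filter] at hη
    refine ⟨blue η, ?_, blue_blue η⟩
    simp only [Finset.mem_filter]
    exact ⟨(blue_mem_avoidBoth_iff ends).2 hη.1, by simpa [blue_blue] using hη.2⟩

/-! ## Closures over all finite graphs -/

/-- Row (2C-1.4) over all finite graphs and all pairs `l ≠ h`. -/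
def CrossRow_all : Prop :=
  ∀ (V E : Type) [Fintype V] [DecidableEq V] [Fintype E] [DecidableEq E] (ends : E → Sym2 V)
    (l h : V), l ≠ h → CrossRow ends l h

/-- Row (2C-1.3) over all finite graphs, all `l` and all sets `S ∌ l` avoided in both colours. -/
def SameRow_all : Prop :=
  ∀ (V E : Type) [Fintype V] [DecidableEq V] [Fintype E] [DecidableEq E] (ends : E → Sym2 V)
    (l : V) (S : Set V), l ∉ S → SameRow ends l S S

/-! ## Symmetries of the cross row -/

/-- The two-colour avoidance is symmetric in `l` and `h`: `h ∉ H_l ↔ l ∉ H_h`. -/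
lemma avoidBoth_comm (l h : V) : avoidBoth ends l h = avoidBoth ends h l := by
  ext ζ
  simp only [mem_avoidBoth, hull, Set.mem_union, mem_cluster]
  constructor
  · intro h' hc
    exact h' (hc.elim (fun c => Or.inl (conn_symm c)) (fun c => Or.inr (conn_symm c)))
  · intro h' hc
    exact h' (hc.elim (fun c => Or.inl (conn_symm c)) (fun c => Or.inr (conn_symm c)))

/-- The colour swap is a bijection of `U` turning both red clusters into the blue ones:
`#{U, C_R(l) ∈ 𝒰, C_R(h) ∈ 𝒱} = #{U, C_B(l) ∈ 𝒰, C_B(h) ∈ 𝒱}` (and the same with one of the two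
conditions dropped, `card_filter_cluster_h_blue`). -/
theorem card_filter_clusters_blue (l h : V) (𝒰 𝒱 : Set (Set V)) :
    ((avoidBoth ends l h).filter fun ζ => cluster ends ζ l ∈ 𝒰 ∧ cluster ends ζ h ∈ 𝒱).card =
      ((avoidBoth ends l h).filter fun ζ =>
        cluster ends (blue ζ) l ∈ 𝒰 ∧ cluster ends (blue ζ) h ∈ 𝒱).card := by
  refine Finset.card_bij (fun ζ _ => blue ζ) ?_ ?_ ?_
  · intro ζ hζ
    simp only [Finset.mem_filter] at hζ ⊢
    exact ⟨(blue_mem_avoidBoth_iff ends).2 hζ.1, by simpa [blue_blue] using hζ.2⟩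
  · intro ζ₁ _ ζ₂ _ h
    have := congrArg blue h
    simpa [blue_blue] using this
  · intro η hη
    simp only [Finset.mem_filter] at hη
    refine ⟨blue η, ?_, blue_blue η⟩
    simp only [Finset.mem_filter]
    exact ⟨(blue_mem_avoidBoth_iff ends).2 hη.1, by simpa [blue_blue] using hη.2⟩

/-- **The cross row in blue**: under `CrossRow`, the blue clusters of `l` and `h` are negatively
correlated on `U` as well. -/
theorem crossRow_blue {l h : V} (hc : CrossRow ends l h) (𝒰 𝒱 : Set (Set V))
    (h𝒰 : IsUpperSet 𝒰) (h𝒱 : IsUpperSet 𝒱) :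
    ((avoidBoth ends l h).filter fun ζ =>
        cluster ends (blue ζ) l ∈ 𝒰 ∧ cluster ends (blue ζ) h ∈ 𝒱).card *
        (avoidBoth ends l h).card ≤
      ((avoidBoth ends l h).filter fun ζ => cluster ends (blue ζ) l ∈ 𝒰).card *
        ((avoidBoth ends l h).filter fun ζ => cluster ends (blue ζ) h ∈ 𝒱).card := by
  have key := hc 𝒰 𝒱 h𝒰 h𝒱
  rw [card_filter_clusters_blue, card_filter_cluster_h_blue] at key
  -- the count of `l` alone: the swap again
  have hl : ((avoidBoth ends l h).filter fun ζ => cluster ends ζ l ∈ 𝒰).card =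
      ((avoidBoth ends l h).filter fun ζ => cluster ends (blue ζ) l ∈ 𝒰).card := by
    rw [avoidBoth_comm]
    exact card_filter_cluster_h_blue ends h l 𝒰
  rw [hl] at key
  exact key

/-! ## The degenerate cases -/

/-- An edge `l – h` empties the two-colour avoidance (it is red or blue). -/
lemma avoidBoth_eq_empty_of_edge {l h : V} {e : E} (he : ends e = s(l, h)) :
    avoidBoth ends l h = ∅ := by
  ext ζ
  simp only [mem_avoidBoth, Finset.notMem_empty, iff_false, not_not, hull, Set.mem_union,
    mem_cluster]
  by_cases hl : l = h
  · subst hl; exact Or.inl (conn_refl _ _ _)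
  · cases hζ : ζ e
    · right
      exact (adj_of_edge (ω := blue ζ) hl (by simp [blue, hζ]) he).reachable
    · left
      exact (adj_of_edge (ω := ζ) hl hζ he).reachable

/-- **The cross row is vacuous across an edge `l – h`.** -/
theorem crossRow_of_edge {l h : V} {e : E} (he : ends e = s(l, h)) : CrossRow ends l h := by
  intro 𝒰 𝒱 _ _
  simp [avoidBoth_eq_empty_of_edge ends he]

/-- **The same row is vacuous when `S` contains a neighbour of `l`.** -/
theorem sameRow_of_edge {l : V} {S : Set V} {h : V} (hS : h ∈ S) {e : E} (he : ends e = s(l, h)) :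
    SameRow ends l S S := by
  intro 𝒰₁ 𝒰₂ _ _
  have hA : avoidRB ends l S S = ∅ := by
    ext ζ
    have := avoidBoth_eq_empty_of_edge ends he
    rw [avoidBoth_eq_avoidRB] at this
    simp only [mem_avoidRB, Finset.notMem_empty, iff_false, not_and]
    intro hR hB
    have hζ : ζ ∈ avoidRB ends l {h} {h} := by
      rw [mem_avoidRB]
      exact ⟨fun x hx => hx ▸ hR h hS, fun y hy => hy ▸ hB h hS⟩
    rw [this] at hζ
    exact Finset.notMem_empty _ hζ
  simp [hA]

/-- In the principal instance with the same vertex on both sides the joint count vanishes: on `U`,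
`o ∈ C_R(l)` and `o ∈ C_R(h)` would put `h` into `C_R(l)`. -/
lemma card_filter_same_vertex (l h o : V) :
    ((avoidBoth ends l h).filter fun ζ => o ∈ cluster ends ζ l ∧ o ∈ cluster ends ζ h).card = 0 := by
  rw [Finset.card_eq_zero, Finset.filter_eq_empty_iff]
  intro ζ hζ ⟨hol, hoh⟩
  rw [mem_avoidBoth] at hζ
  exact hζ (Or.inl (conn_trans hol (conn_symm hoh)))

end TwoColour

end Summit.Ventures.PercRepro2
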